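import Mathlib
import HarnessLib
import Summits.PneNP.Statement
import Literature.Computability.Complexity.CNF
import Literature.Computability.Complexity.PNPWave0
import Literature.Computability.Complexity.RandomKSatUniformlyPos
import Summits.PneNP.PneNP.Theorems.OverlapGapAlgebraAssembly
import Summits.PneNP.PneNP.Theorems.OverlapGapAlgebraEvalRelationInP

/-!
# PneNP / OverlapGapAlgebra — `SearchHardWindow` (stmt-PneNP-2460): ROUTE-FILE-FREE window glue

This module does NOT import the route file `Summits.PneNP.PneNP.Theses.OverlapGapAlgebra` (nor any
module importing it). It states everything on the VERBATIM bodies of the route decls, so that the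
route file itself — in particular its deciding theorem `closes` — may import it without an import
cycle (the render blocker "R3" of `Cruxes/SearchHardWindow/STRATEGY-CENSUS.md` §0.3: today the
window glue `positiveSatProbability_window_density_lt_rho` / `searchHardWindow_of_hard_at_window`
lives in modules that import the route file).

Write `H(k)` for the bare hardness conjunct of the crux at the window density
`α_k = 5 · 2^k · log k / k`: every polynomial-time word function `f` (tree `IsPolyTime`; input the
`encodingCNF`-code of the clause list of `Φ`, output word read as the table `v ↦ y.getD v false`)
solves the random literal array `F_k(n, ⌊α_k n⌋)` with probability `→ 0`. It is written INLINE as a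
binder below (it is the one open stub `stub_windowHard` of line `IdeaSketch_r2_k6` v3 of the crux,
and the body of the conditional bridge `RandomKSatWindowHard` proposed in STRATEGY-CENSUS §0.2(b);
being an open CONJECTURE of `P ≠ NP` strength it is deliberately not a definition here).

* `shwW_posSat_window`           : uniformly positive satisfiability of `F_k(n, ⌊α_k n⌋)`, `k ≥ 1024`,
  as the route's counting ratio (Achlioptas–Peres 2004, `achlioptasPeres2004_uniformlyPos`, with the
  comparison `α_k < ρ_k` re-derived inside the proof — its tree form
  `positiveSatProbability_window_density_lt_rho` lives in a module importing the route file).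
* `shwW_positiveSatProbability_standalone` : the body of item stmt-PneNP-2464
  (`PositiveSatProbability`) verbatim, route-free (a standalone witness the gate can link without a
  cycle, cf. the `ClassBridges` precedent).
* `shwW_searchHardWindow_of_windowHard` : `(∃ k ≥ 1024, H(k)) →` the body of `SearchHardWindow`
  verbatim — the composition of line `IdeaSketch_r2_k6` v3 with its kernel explicit.
* `shwW_pneNP_of_windowHard`     : `(∃ k ≥ 1024, H(k)) → PneNP` — the kernel is crux-sized
  (summit-strength), through the route-free assembly `overlapGapAlgebra_assembly_proof` and plumbing
  `overlapGap_evalRelationInP`.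

No definitions are introduced. Lead prover-line-stmt-PneNP-2460-c4-0, 2026-08-17.
-/

namespace Summit.PneNP.PneNP.Theorems

set_option linter.dupNamespace false -- `Summit.PneNP.PneNP.…`: summit = sub-problem (D-0017)

open Filter Literature.Computability.Complexity

/-! ## Uniformly positive satisfiability at the window, in the route's counting-ratio form

The comparison `α_k < ρ_k` (`k ≥ 1024`) is the tree theorem
`positiveSatProbability_window_density_lt_rho`, whose module imports the route file; to stay
route-free it is re-derived INSIDE the proof of `shwW_posSat_window` (same elementary estimates:
`log k ≤ k/10` for `k ≥ 400`, `1024 k² ≤ 2^k` for `k ≥ 1024`, `0.6931 < log 2 < 0.6932`). -/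

/-- **Positive satisfiability at the window density** (Achlioptas–Peres 2004, the second-moment
theorem behind their Thm. 2, held unconditionally as `achlioptasPeres2004_uniformlyPos`): for every
`k ≥ 1024` there is `ε > 0` such that for all large `n`, with `m = ⌊5 · 2^k log k / k · n⌋₊`, at least
an `ε`-fraction of the literal arrays `Φ : Fin m → Fin k → Fin n × Bool` are satisfiable — stated on
the route's own counting ratio, route-free. [cite: AchlioptasPeres2004, §7 p. 16 with Lemma 1 p. 3] -/
theorem shwW_posSat_window {k : ℕ} (hk : 1024 ≤ k) :
    ∃ ε : ℝ, 0 < ε ∧ ∀ᶠ n : ℕ in Filter.atTop, ∀ m : ℕ, m = ⌊5 * 2 ^ k * Real.log k / k * n⌋₊ →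
      ε ≤ ((Finset.univ.filter fun Φ : Fin m → Fin k → Fin n × Bool =>
        ∃ σ : Fin n → Bool, ∀ i, ∃ j, σ (Φ i j).1 = (Φ i j).2).card : ℝ) /
          Fintype.card (Fin m → Fin k → Fin n × Bool) := by
  -- (1) elementary estimates
  have hkr : (1024 : ℝ) ≤ k := by exact_mod_cast hk
  have hkpos : (0 : ℝ) < k := by linarith
  have hlog2 : (0.6931471803 : ℝ) < Real.log 2 := Real.log_two_gt_d9
  have hlog2' : Real.log 2 < 0.6931471808 := Real.log_two_lt_d9
  -- `log k ≤ k / 10` (from `1 + y ≤ e^y` at `y = k/20`)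
  have hlog : Real.log k ≤ k / 10 := by
    rw [Real.log_le_iff_le_exp hkpos]
    have h1 : 1 + (k : ℝ) / 20 ≤ Real.exp (k / 20) := by linarith [Real.add_one_le_exp ((k : ℝ) / 20)]
    have h2 : Real.exp ((k : ℝ) / 10) = Real.exp (k / 20) ^ 2 := by
      rw [sq, ← Real.exp_add]; ring_nf
    rw [h2]
    have h3 : (0 : ℝ) ≤ 1 + k / 20 := by linarith
    have h4 : 0 ≤ (k : ℝ) * (k - 400) := mul_nonneg hkpos.le (by linarith)
    calc (k : ℝ) ≤ (1 + k / 20) ^ 2 := by nlinarith [h4]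
      _ ≤ Real.exp (k / 20) ^ 2 := pow_le_pow_left₀ h3 h1 2
  -- `1024 k² ≤ k³ ≤ 2^k`
  have hP : 1024 * (k : ℝ) ^ 2 ≤ 2 ^ k := by
    have hcube : (k : ℝ) ^ 3 ≤ 2 ^ k := by
      have e1 : (k : ℝ) ^ 3 = Real.exp (3 * Real.log k) := by
        rw [show (3 : ℝ) * Real.log k = ((3 : ℕ) : ℝ) * Real.log k by norm_num, Real.exp_nat_mul,
          Real.exp_log hkpos]
      have e2 : (2 : ℝ) ^ k = Real.exp (k * Real.log 2) := by
        rw [Real.exp_nat_mul, Real.exp_log two_pos]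
      rw [e1, e2, Real.exp_le_exp]
      have hkl : 0.6931471803 * (k : ℝ) ≤ k * Real.log 2 := by nlinarith
      linarith
    have hk2 : 1024 * (k : ℝ) ^ 2 ≤ (k : ℝ) ^ 3 := by nlinarith
    exact hk2.trans hcube
  -- (2) `α_k < ρ_k`
  have hlt : 5 * 2 ^ k * Real.log k / k < (2 ^ k * Real.log 2 - ((k : ℝ) + 1) * Real.log 2 / 2 - 1) -
      2 * (15 * (k : ℝ) ^ 2 / 2 ^ k + (((k : ℝ) + 3) / 2 ^ k + 32 * (k : ℝ) ^ 2 * (50 / 81) ^ k +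
        32 * (k : ℝ) * (5 / 9) ^ k)) := by
    have h2kpos : (0 : ℝ) < 2 ^ k := by positivity
    have hA : (50 / 81 : ℝ) ^ k ≤ 1 := pow_le_one₀ (by norm_num) (by norm_num)
    have hB : (5 / 9 : ℝ) ^ k ≤ 1 := pow_le_one₀ (by norm_num) (by norm_num)
    have hA0 : (0 : ℝ) ≤ (50 / 81 : ℝ) ^ k := by positivity
    have hB0 : (0 : ℝ) ≤ (5 / 9 : ℝ) ^ k := by positivity
    have hk2 : 1024 * (k : ℝ) ≤ (k : ℝ) ^ 2 := by nlinarith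
    have hL : 5 * 2 ^ k * Real.log k / k ≤ 2 ^ k / 2 := by
      rw [div_le_iff₀ hkpos]
      have : 5 * 2 ^ k * Real.log k ≤ 5 * 2 ^ k * (k / 10) :=
        mul_le_mul_of_nonneg_left hlog (by positivity)
      linarith
    have hT1 : 15 * (k : ℝ) ^ 2 / 2 ^ k ≤ 1 := by
      rw [div_le_one h2kpos]; nlinarith
    have hT2 : ((k : ℝ) + 3) / 2 ^ k ≤ 1 := by
      rw [div_le_one h2kpos]; linarith
    have hT3 : 32 * (k : ℝ) ^ 2 * (50 / 81) ^ k ≤ 32 * (k : ℝ) ^ 2 := by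
      have : 32 * (k : ℝ) ^ 2 * (50 / 81) ^ k ≤ 32 * (k : ℝ) ^ 2 * 1 :=
        mul_le_mul_of_nonneg_left hA (by positivity)
      linarith
    have hT4 : 32 * (k : ℝ) * (5 / 9) ^ k ≤ 32 * (k : ℝ) := by
      have : 32 * (k : ℝ) * (5 / 9) ^ k ≤ 32 * (k : ℝ) * 1 :=
        mul_le_mul_of_nonneg_left hB (by positivity)
      linarith
    have hM : 0.6931471803 * (2 : ℝ) ^ k ≤ 2 ^ k * Real.log 2 := by nlinarith
    have hN : ((k : ℝ) + 1) * Real.log 2 ≤ 0.6931471808 * ((k : ℝ) + 1) := by nlinarith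
    linarith
  -- (3) Achlioptas–Peres at `r = α_k`
  obtain ⟨c, hc, hev⟩ :=
    achlioptasPeres2004_uniformlyPos (r := 5 * 2 ^ k * Real.log k / k) hk hlt
  refine ⟨c, hc, ?_⟩
  filter_upwards [hev] with n hn m hm
  subst hm
  simpa [litArraySatProb, LitArraySat] using hn

/-- **Item stmt-PneNP-2464's statement, route-free.** The body of the route decl
`PositiveSatProbability` verbatim (`k₀ = 1024`), proved without importing the route file, so that a
rendered route file can link it (`theorem PositiveSatProbability_holds : PositiveSatProbability :=
shwW_positiveSatProbability_standalone` elaborates by unfolding) without the import cycle through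
`OverlapGapAlgebraPositiveSatProbability.lean`. [cite: AchlioptasPeres2004, §7 p. 16 with Lemma 1 p. 3] -/
theorem shwW_positiveSatProbability_standalone :
    ∃ k₀ : ℕ, ∀ k ≥ k₀, ∃ ε : ℝ, 0 < ε ∧ ∀ᶠ n : ℕ in Filter.atTop, ∀ m : ℕ,
      m = ⌊5 * 2 ^ k * Real.log k / k * n⌋₊ →
        ε ≤ ((Finset.univ.filter fun Φ : Fin m → Fin k → Fin n × Bool =>
          ∃ σ : Fin n → Bool, ∀ i, ∃ j, σ (Φ i j).1 = (Φ i j).2).card : ℝ) /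
            Fintype.card (Fin m → Fin k → Fin n × Bool) :=
  ⟨1024, fun _ hk => shwW_posSat_window hk⟩

/-! ## The window kernel gives the crux and the summit (route-free composition) -/

/-- **Line `IdeaSketch_r2_k6` v3, composition with the kernel explicit (route-free).** If for some
`k ≥ 1024` every polynomial-time word function solves `F_k(n, ⌊α_k n⌋)` with probability `→ 0`
(the bare hardness conjunct `H(k)` at the window density `α_k = 5 · 2^k log k / k` — the open,
`P ≠ NP`-strength kernel), then the body of the crux `SearchHardWindow` holds, witnessed at
`(k, α_k)`: the positivity conjunct is `shwW_posSat_window`. Inside the route file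
`have hX : SearchHardWindow := shwW_searchHardWindow_of_windowHard hH` elaborates by unfolding.
[AchlioptasPeres2004, Thm. 2; BreslerHuang2022, Thm. 2.6 (the window)] -/
theorem shwW_searchHardWindow_of_windowHard :
    (∃ k : ℕ, 1024 ≤ k ∧ ∀ f : List Bool → List Bool,
    Literature.Computability.Complexity.IsPolyTime f → ∀ ε : ℝ, 0 < ε → ∀ᶠ n : ℕ in Filter.atTop,
    ∀ m : ℕ, m = ⌊5 * 2 ^ k * Real.log k / k * n⌋₊ → ((Finset.univ.filter fun Φ : Fin m → Fin k →
    Fin n × Bool => ∀ i, ∃ j, (f (Literature.Computability.Complexity.encodingCNF.encode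
    (List.ofFn fun a => List.ofFn fun b => (((Φ a b).1 : ℕ), (Φ a b).2)))).getD (Φ i j).1 false =
    (Φ i j).2).card : ℝ) / Fintype.card (Fin m → Fin k → Fin n × Bool) ≤ ε) → ∃ (k : ℕ) (α : ℝ),
    (∃ ε : ℝ, 0 < ε ∧ ∀ᶠ n : ℕ in Filter.atTop, ∀ m : ℕ, m = ⌊α * n⌋₊ → ε ≤ ((Finset.univ.filter
    fun Φ : Fin m → Fin k → Fin n × Bool => ∃ σ : Fin n → Bool, ∀ i, ∃ j, σ (Φ i j).1 = (Φ i
    j).2).card : ℝ) / Fintype.card (Fin m → Fin k → Fin n × Bool)) ∧ ∀ f : List Bool → List Bool,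
    Literature.Computability.Complexity.IsPolyTime f → ∀ ε : ℝ, 0 < ε → ∀ᶠ n : ℕ in Filter.atTop,
    ∀ m : ℕ, m = ⌊α * n⌋₊ → ((Finset.univ.filter fun Φ : Fin m → Fin k → Fin n × Bool => ∀ i, ∃ j,
    (f (Literature.Computability.Complexity.encodingCNF.encode (List.ofFn fun a => List.ofFn fun b
    => (((Φ a b).1 : ℕ), (Φ a b).2)))).getD (Φ i j).1 false = (Φ i j).2).card : ℝ) / Fintype.card
    (Fin m → Fin k → Fin n × Bool) ≤ ε := by
  rintro ⟨k, hk, hhard⟩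
  exact ⟨k, 5 * 2 ^ k * Real.log k / k, shwW_posSat_window hk, hhard⟩

/-- **The window kernel is crux-sized (summit-strength), route-free.** The same hypothesis — `H(k)`
for one `k ≥ 1024` — proves the summit statement `PneNP` outright, through
`shwW_searchHardWindow_of_windowHard`, the route-free assembly
`overlapGapAlgebra_assembly_proof` (search-to-decision, Arora–Barak Thm. 2.18) and the plumbing
theorem `overlapGap_evalRelationInP`. So the one stub of line `IdeaSketch_r2_k6` v3 is not smaller
than the crux: it IS the crux's hardness core (the positivity conjunct being a theorem).
[AroraBarakCC2009, Thm. 2.18; AchlioptasPeres2004, §11 Question 2] -/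
theorem shwW_pneNP_of_windowHard
    (hH : ∃ k : ℕ, 1024 ≤ k ∧ ∀ f : List Bool → List Bool, IsPolyTime f → ∀ ε : ℝ, 0 < ε →
      ∀ᶠ n : ℕ in Filter.atTop, ∀ m : ℕ, m = ⌊5 * 2 ^ k * Real.log k / k * n⌋₊ →
        ((Finset.univ.filter fun Φ : Fin m → Fin k → Fin n × Bool => ∀ i, ∃ j,
          (f (encodingCNF.encode (List.ofFn fun a => List.ofFn fun b =>
            (((Φ a b).1 : ℕ), (Φ a b).2)))).getD (Φ i j).1 false = (Φ i j).2).card : ℝ) /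
          Fintype.card (Fin m → Fin k → Fin n × Bool) ≤ ε) :
    _root_.PneNP :=
  overlapGapAlgebra_assembly_proof overlapGap_evalRelationInP (shwW_searchHardWindow_of_windowHard hH)

end Summit.PneNP.PneNP.Theorems
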